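/-
Copyright (c) 2026. All rights reserved.
Released under Apache 2.0 license as described in the file LICENSE.
Authors: abc-iut cell, wave-2 seat abc-iut-L3-t11 (G10 rung 4: [SemiAnbd] Thm 3.7 (iv) as a reduction).
-/
import Literature.AnabelianGeometry.SemiGraphs.TemperedVerticial
import Literature.AnabelianGeometry.SemiGraphs.TemperoidsResProofs
import HarnessLib

/-!
# [SemiAnbd] Theorem 3.7 (iv): maximal compact subgroups of `π₁^temp(G)` — reduction to (ii), (iii)

Mochizuki, *Semi-graphs of anabelioids*, Publ. RIMS **42** (2006) [MochizukiSemiAnbd2006], Theorem 3.7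
(iv) p. 41: "The maximal compact subgroups of `π₁^temp(G)` are precisely the verticial subgroups. The
nontrivial intersections of two distinct maximal compact subgroups of `π₁^temp(G)` are precisely the
edge-like subgroups" — typed by abc-iut-L3-t2 as `ProfiniteSemiGraph.MaximalCompactIffVerticial`
(`TemperedVerticial.lean`, G10 ladder rung 4).

This file PROVES rung 4 from the lower rungs, in the paper's own order ("(iv) follows from (ii), (iii)"):

* chart lemmas (unconditional): a tempered fundamental group is Hausdorff (`TemperedPiChart.t2Space`);
  verticial subgroups are compact (`isCompact_of_mem_verticialSubgroups`, images of the profinite `Π_v`);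
  the verticial subgroups at a vertex form ONE conjugacy class (`exists_conj_of_mem_verticialSubgroups`,
  `conj_mem_verticialSubgroups` — [SemiAnbd] Prop 3.2 via the tree's `BTemp.exists_conj_of_natTrans` /
  `BTemp.resIsoOfConj`);
* `eq_of_le_of_mem_verticialSubgroups` — under Thm 3.7 (ii) (`VerticialDistinct`) nested verticial
  subgroups are equal;
* `isMaximalCompactSubgroup_iff_mem_verticialSubgroups` — **first sentence of (iv)** from Thm 3.7 (ii) +
  the first part of (iii) (`CompactInVerticial`);
* `MaximalCompactIffVerticial_of` — **all of (iv)** from (ii), (iii) and the named residual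
  `EdgeLikeIsInfVerticial` (p. 41: an edge-like subgroup of a closed edge is the intersection of the two —
  distinct — verticial subgroups of its end-vertices, i.e. `D_e = D_{v₁} ∩ D_{v₂}` on the universal
  pro-covering tree; owed to G10 rung 1, the identification of verticial/edge-like subgroups with
  decomposition groups).

One definition (the named residual); no statement of the paper is strengthened; nothing here bears on
[IUTchIII] Cor. 3.12.
-/

namespace Literature.AnabelianGeometry.SemiGraphs

open CategoryTheory Topology

universe u

namespace ProfiniteSemiGraph

variable {𝒢 : ProfiniteSemiGraph.{u}}

/-! ### Chart lemmas -/

/-- A tempered fundamental group is Hausdorff (open normal subgroups separate points).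
[cite: MochizukiSemiAnbd2006, Prop 3.6(i) p.38] -/
theorem TemperedPiChart.t2Space (c : TemperedPiChart 𝒢) : T2Space c.G := by
  apply IsTopologicalGroup.t2Space_of_one_sep
  intro g hg
  obtain ⟨N, hN⟩ := c.isTempered.separated g hg
  exact ⟨N, N.isOpen.mem_nhds N.one_mem, hN⟩

/-- Verticial subgroups are compact ("[necessarily compact!]", p. 40): they are images of the profinite
groups `Π_v` under continuous homomorphisms. [cite: MochizukiSemiAnbd2006, Thm 3.7(i) p.40] -/
theorem isCompact_of_mem_verticialSubgroups (c : TemperedPiChart 𝒢) {v : 𝒢.graph.Vertex}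
    {H : Subgroup c.G} (hH : H ∈ verticialSubgroups c v) : IsCompact (H : Set c.G) := by
  obtain ⟨φ, -, rfl⟩ := hH
  rw [MonoidHom.coe_range]
  exact isCompact_range φ.continuous

/-- Edge-like subgroups are compact (images of the profinite `Π_e`). [cite: MochizukiSemiAnbd2006, Thm 3.7(iii) p.41] -/
theorem isCompact_of_mem_edgeLikeSubgroups (c : TemperedPiChart 𝒢) {e : 𝒢.graph.Edge}
    {L : Subgroup c.G} (hL : L ∈ edgeLikeSubgroups c e) : IsCompact (L : Set c.G) := by
  obtain ⟨φ, -, rfl⟩ := hL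
  rw [MonoidHom.coe_range]
  exact isCompact_range φ.continuous

/-- The range of `γ_g ∘ φ` is the conjugate `g·(range φ)·g⁻¹`. [cite: MochizukiSemiAnbd2006, Prop 3.2 p.35] -/
theorem range_eq_map_conj_of_conj_eq (c : TemperedPiChart 𝒢) {Γ : Type u} [Group Γ]
    [TopologicalSpace Γ] (φ ψ : Γ →ₜ* c.G) (g : c.G) (hg : ∀ a, g * φ a * g⁻¹ = ψ a) :
    ψ.toMonoidHom.range = φ.toMonoidHom.range.map (MulAut.conj g).toMonoidHom := by
  ext x
  simp only [MonoidHom.mem_range, Subgroup.mem_map, ContinuousMonoidHom.coe_toMonoidHom,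
    MulEquiv.coe_toMonoidHom, MulAut.conj_apply, exists_exists_eq_and]
  constructor
  · rintro ⟨a, rfl⟩; exact ⟨a, hg a⟩
  · rintro ⟨a, rfl⟩; exact ⟨a, (hg a).symm⟩

/-- **The verticial subgroups at `v` form one conjugacy class** (Prop 3.2: two continuous
homomorphisms with isomorphic pull-back functors differ by an inner automorphism — the tree's
`BTemp.exists_conj_of_natTrans`). [cite: MochizukiSemiAnbd2006, Thm 3.7(i) p.40] -/
theorem exists_conj_of_mem_verticialSubgroups (c : TemperedPiChart 𝒢) {v : 𝒢.graph.Vertex}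
    {H H' : Subgroup c.G} (hH : H ∈ verticialSubgroups c v) (hH' : H' ∈ verticialSubgroups c v) :
    ∃ g : c.G, H' = H.map (MulAut.conj g).toMonoidHom := by
  obtain ⟨φ, ⟨e⟩, rfl⟩ := hH
  obtain ⟨φ', ⟨e'⟩, rfl⟩ := hH'
  obtain ⟨g, hg, -⟩ := BTemp.exists_conj_of_natTrans c.isTempered φ φ' (e.symm ≪≫ e').hom
  exact ⟨g, range_eq_map_conj_of_conj_eq c φ φ' g hg⟩

/-- Conjugates of verticial subgroups are verticial (the pull-back functors of `φ` and `γ_g ∘ φ` are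
isomorphic, the tree's `BTemp.resIsoOfConj`). [cite: MochizukiSemiAnbd2006, Thm 3.7(i) p.40] -/
theorem conj_mem_verticialSubgroups (c : TemperedPiChart 𝒢) {v : 𝒢.graph.Vertex} {H : Subgroup c.G}
    (hH : H ∈ verticialSubgroups c v) (g : c.G) :
    H.map (MulAut.conj g).toMonoidHom ∈ verticialSubgroups c v := by
  obtain ⟨φ, ⟨e⟩, rfl⟩ := hH
  -- `γ_g ∘ φ` as a continuous homomorphism
  let ψ : 𝒢.Gv v →ₜ* c.G :=
    { toMonoidHom := (MulAut.conj g).toMonoidHom.comp φ.toMonoidHom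
      continuous_toFun := by
        exact ((continuous_const.mul continuous_id).mul continuous_const).comp φ.continuous }
  have hg : ∀ a, g * φ a * g⁻¹ = ψ a := fun a => rfl
  exact ⟨ψ, ⟨e ≪≫ BTemp.resIsoOfConj φ ψ g hg⟩, (range_eq_map_conj_of_conj_eq c φ ψ g hg).symm⟩

/-- The same two facts for edge-like subgroups: one conjugacy class per edge.
[cite: MochizukiSemiAnbd2006, Thm 3.7(iii) p.41] -/
theorem exists_conj_of_mem_edgeLikeSubgroups (c : TemperedPiChart 𝒢) {e : 𝒢.graph.Edge}
    {L L' : Subgroup c.G} (hL : L ∈ edgeLikeSubgroups c e) (hL' : L' ∈ edgeLikeSubgroups c e) :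
    ∃ g : c.G, L' = L.map (MulAut.conj g).toMonoidHom := by
  obtain ⟨φ, ⟨i⟩, rfl⟩ := hL
  obtain ⟨φ', ⟨i'⟩, rfl⟩ := hL'
  obtain ⟨g, hg, -⟩ := BTemp.exists_conj_of_natTrans c.isTempered φ φ' (i.symm ≪≫ i').hom
  exact ⟨g, range_eq_map_conj_of_conj_eq c φ φ' g hg⟩

/-! ### Nested verticial subgroups are equal (from Theorem 3.7 (ii)) -/

/-- Conjugating by `1` does nothing. [folklore] -/
private theorem map_conj_one {Γ : Type u} [Group Γ] (H : Subgroup Γ) :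
    H.map (MulAut.conj (1 : Γ)).toMonoidHom = H := by
  ext x; simp

/-- Under Thm 3.7 (ii) (`VerticialDistinct`), a verticial subgroup contained in another verticial
subgroup equals it: distinct vertices give infinite index (impossible for `K ≤ H`), equal vertices make
`H = g K g⁻¹` and `g ∉ K` would again give infinite index. [cite: MochizukiSemiAnbd2006, Thm 3.7(ii) p.40] -/
theorem eq_of_le_of_mem_verticialSubgroups (hVD : VerticialDistinct.{u}) (h𝒢 : 𝒢.Thm37Hypotheses)
    (c : TemperedPiChart 𝒢) {v v' : 𝒢.graph.Vertex} {K H : Subgroup c.G}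
    (hK : K ∈ verticialSubgroups c v) (hH : H ∈ verticialSubgroups c v') (hle : K ≤ H) : K = H := by
  obtain ⟨h1, h2⟩ := hVD 𝒢 h𝒢 c
  have hidx : H.relIndex K = 1 := Subgroup.relIndex_eq_one.mpr hle
  -- the vertices agree
  have hvv : v = v' := by
    by_contra hne
    have := h1 v v' K H hK hH hne
    omega
  subst hvv
  -- `H = g K g⁻¹`, and `g ∈ K`
  obtain ⟨g, rfl⟩ := exists_conj_of_mem_verticialSubgroups c hK hH
  by_cases hg : g ∈ K
  · ext x
    simp only [Subgroup.mem_map, MulEquiv.coe_toMonoidHom, MulAut.conj_apply]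
    constructor
    · intro hx; exact ⟨g⁻¹ * x * g, by
        refine ⟨K.mul_mem (K.mul_mem (K.inv_mem hg) hx) hg, by group⟩⟩
    · rintro ⟨y, hy, rfl⟩; exact K.mul_mem (K.mul_mem hg hy) (K.inv_mem hg)
  · exfalso
    have h0 := h2 v K hK 1 g (by simpa using hg)
    rw [map_conj_one] at h0
    omega

/-! ### Theorem 3.7 (iv), first sentence, from (ii) and (iii) -/

/-- **[SemiAnbd] Thm 3.7 (iv), first sentence, from (ii) + (iii)**: the maximal compact subgroups of
`π₁^temp(G)` are precisely the verticial subgroups — a compact subgroup lies in a verticial one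
((iii), first part), verticial subgroups are compact, and nested verticial subgroups coincide ((ii)).
[cite: MochizukiSemiAnbd2006, Thm 3.7(iv) p.41] -/
theorem isMaximalCompactSubgroup_iff_mem_verticialSubgroups (hCV : CompactInVerticial.{u})
    (hVD : VerticialDistinct.{u}) (h𝒢 : 𝒢.Thm37Hypotheses) (c : TemperedPiChart 𝒢) (K : Subgroup c.G) :
    IsMaximalCompactSubgroup K ↔ ∃ v, K ∈ verticialSubgroups c v := by
  constructor
  · rintro ⟨hKc, hmax⟩
    obtain ⟨⟨v, H, hH, hKH⟩, -⟩ := hCV 𝒢 h𝒢 c K hKc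
    exact ⟨v, (hmax H (isCompact_of_mem_verticialSubgroups c hH) hKH) ▸ hH⟩
  · rintro ⟨v, hK⟩
    refine ⟨isCompact_of_mem_verticialSubgroups c hK, fun K' hK'c hKK' => ?_⟩
    obtain ⟨⟨v', H', hH', hK'H'⟩, -⟩ := hCV 𝒢 h𝒢 c K' hK'c
    have hKH' : K = H' := eq_of_le_of_mem_verticialSubgroups hVD h𝒢 c hK hH' (hKK'.trans hK'H')
    exact le_antisymm (hKH' ▸ hK'H') hKK'

/-! ### Theorem 3.7 (iv), second sentence: the named residual and the full reduction -/

/-- **Named residual of rung 4** ([SemiAnbd] Thm 3.7 (iv) p. 41 with (iii) p. 40–41; print mechanism: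
on the universal pro-covering tree the decomposition group of a closed edge is the intersection of the
decomposition groups of its two end-vertices, `D_e = D_{v₁} ∩ D_{v₂}`, and these two are distinct): every
nontrivial edge-like subgroup of a CLOSED edge is the intersection of two DISTINCT verticial subgroups.
Owed to G10 rung 1 (identification of verticial / edge-like subgroups with decomposition groups of the
universal graph-covering); consumed by `MaximalCompactIffVerticial_of`.
[cite: MochizukiSemiAnbd2006, Thm 3.7(iv) p.41] -/
def EdgeLikeIsInfVerticial : Prop :=
  ∀ (𝒢 : ProfiniteSemiGraph.{u}), 𝒢.Thm37Hypotheses → ∀ (c : TemperedPiChart 𝒢) (e : 𝒢.graph.Edge),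
    𝒢.graph.IsClosedEdge e → ∀ L ∈ edgeLikeSubgroups c e, L ≠ ⊥ →
      ∃ (v₁ v₂ : 𝒢.graph.Vertex) (H₁ H₂ : Subgroup c.G), H₁ ∈ verticialSubgroups c v₁ ∧
        H₂ ∈ verticialSubgroups c v₂ ∧ H₁ ≠ H₂ ∧ L = H₁ ⊓ H₂

/-- **[SemiAnbd] Thm 3.7 (iv) from (ii), (iii) and the residual `EdgeLikeIsInfVerticial`** — G10 rung 4
as a reduction: maximal compact ⇔ verticial (first sentence, unconditionally in (ii)+(iii)); a nontrivial
`L` is the intersection of two distinct maximal compact subgroups iff it is an edge-like subgroup of a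
closed edge (`⇐` by the residual; `⇒`: `L = K₁ ⊓ K₂` is compact — `π₁^temp` is Hausdorff — and lies in the
two distinct verticial subgroups `K₁`, `K₂`, so by (iii), second part, in an edge-like `L'` of a closed
edge, and `L' = H₁ ⊓ H₂` with `Hᵢ` verticial containing `L`, hence `{H₁, H₂} = {K₁, K₂}` and `L' = L`).
[cite: MochizukiSemiAnbd2006, Thm 3.7(iv) p.41] -/
theorem MaximalCompactIffVerticial_of (hCV : CompactInVerticial.{u}) (hVD : VerticialDistinct.{u})
    (hE : EdgeLikeIsInfVerticial.{u}) : MaximalCompactIffVerticial.{u} := by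
  intro 𝒢 h𝒢 c
  have hiff := isMaximalCompactSubgroup_iff_mem_verticialSubgroups hCV hVD h𝒢 c
  refine ⟨hiff, fun L hL => ⟨?_, ?_⟩⟩
  · -- `⇒`: intersections of two distinct maximal compact subgroups are edge-like
    rintro ⟨K₁, K₂, hK₁, hK₂, hne, rfl⟩
    obtain ⟨v₁, hK₁v⟩ := (hiff K₁).mp hK₁
    obtain ⟨v₂, hK₂v⟩ := (hiff K₂).mp hK₂
    haveI := c.t2Space
    have hLc : IsCompact ((K₁ ⊓ K₂ : Subgroup c.G) : Set c.G) := by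
      rw [Subgroup.coe_inf]
      exact hK₁.1.inter_right hK₂.1.isClosed
    obtain ⟨-, h2⟩ := hCV 𝒢 h𝒢 c (K₁ ⊓ K₂) hLc
    obtain ⟨honly, e, L', he, hL', hLL'⟩ := h2 hL v₁ v₂ K₁ K₂ hK₁v hK₂v hne inf_le_left inf_le_right
    have hL'ne : L' ≠ ⊥ := fun h => hL (le_bot_iff.mp (h ▸ hLL'))
    obtain ⟨w₁, w₂, H₁, H₂, hH₁, hH₂, hH, rfl⟩ := hE 𝒢 h𝒢 c e he L' hL' hL'ne
    have hH₁' := honly w₁ H₁ hH₁ (hLL'.trans inf_le_left)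
    have hH₂' := honly w₂ H₂ hH₂ (hLL'.trans inf_le_right)
    refine ⟨e, he, ?_⟩
    rcases hH₁' with rfl | rfl <;> rcases hH₂' with rfl | rfl
    · exact absurd rfl hH
    · exact hL'
    · rw [inf_comm]; exact hL'
    · exact absurd rfl hH
  · -- `⇐`: edge-like subgroups of closed edges are such intersections
    rintro ⟨e, he, hLe⟩
    obtain ⟨v₁, v₂, H₁, H₂, hH₁, hH₂, hH, rfl⟩ := hE 𝒢 h𝒢 c e he _ hLe hL
    exact ⟨H₁, H₂, (hiff H₁).mpr ⟨v₁, hH₁⟩, (hiff H₂).mpr ⟨v₂, hH₂⟩, hH, rfl⟩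

end ProfiniteSemiGraph

end Literature.AnabelianGeometry.SemiGraphs
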